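import Mathlib
import HarnessLib
import Summits.HubbardSuperconductivity.HubbardSuperconductivity.Theorems.KLProgrammeKLRegimeTwoLegCurvatureDefs

/-!
# K3 gen-7-FLOW (plan g16 K3-FLOW RULING F, KL STATUS 2026-08-27 l.2548; (ρF-1) l.2568): the PARAMETRIC cumulative-reading jet predicate
# `TwoLegReadJetBound L M c c' β U μ K n` — what stub 6-F concludes at c4a-1's natural tables, what (M)/(e) read at the package tables

Cell gate-hubbard-kl, seat p2 g10 (bundle typist).  The CUMULATIVE-READING twin of `TwoLegCurveJetBound` (p517656): the profile is the scale-`n` local part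
ITSELF, `θ ↦ ν_n(K)(θ) = klLocalPart L M β U μ K n θ` (not the increment profile `klTwoLegCurveProfile`), read at an ARBITRARY frame `K` — the V17F two-leg
slot `TwoLegReadJetsF L M G Q β U μ n` (`…SplitSlotsV17F` §3) is LITERALLY `TwoLegReadJetBound L M G.S Q.S' β U μ (klFlowFrameU L M β U μ n) n`
(`Iff.rfl`, stated downstream of both files), and stub 6-F is this predicate at the tables (`klC4aJetC`, `klC4aJetC' P R`), reaching the package form by
`.mono` + the two package inequalities exactly as in scheme C ((R25)(b)).

* `TwoLegReadJetBound L M c c' β U μ K n : Prop := ContDiff ℝ 4 (θ ↦ ν_n(K)(θ)) ∧ ∀ k ≤ 4, ∀ θ, |∂_θ^k ν_n(K)(θ)| ≤ curveJetBar c c' U k n`;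
* accessors `.contDiff`, `.le`, monotonicity in the tables `.mono`, and `twoLegReadJetBound_GS_of_le` (tables below `(G.S, Q.S')` ⇒ the package form).

Definitions + bookkeeping only; nothing about the model is asserted; nothing asserts superconductivity.
-/

noncomputable section

namespace Summit.HubbardSuperconductivity.HubbardSuperconductivity.Theorems.KLRegimeSplit

set_option linter.dupNamespace false -- summit = problem name (single-conjunct summit), D-0017

open Literature.MathematicalPhysics.QuantumLattice Literature.Probability.LatticeModels

section Model

variable (L M : ℕ) [NeZero L] [NeZero M]

/-- **`TwoLegReadJetBound L M c c' β U μ K n`** — the CUMULATIVE reading `θ ↦ ν_n(K)(θ) = klLocalPart L M β U μ K n θ` is `C⁴` in the angle with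
`|∂_θ^k ν_n(K)(θ)| ≤ curveJetBar c c' U k n = (c_k + c′_k|U|)·uPow k U·4^{(k−2)n}` for `k ≤ 4` (parametric tables `c, c' : ℕ → ℝ`; frame `K` arbitrary —
under scheme F it is read at `K := klFlowFrameU L M β U μ n`). -/
def TwoLegReadJetBound (c c' : ℕ → ℝ) (β U μ : ℝ) (K : TrigPolyC4v) (n : ℕ) : Prop :=
  ContDiff ℝ 4 (fun θ : ℝ => klLocalPart L M β U μ K n θ) ∧
    ∀ k ≤ 4, ∀ θ : ℝ, |iteratedDeriv k (fun θ : ℝ => klLocalPart L M β U μ K n θ) θ| ≤ curveJetBar c c' U k n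

end Model

section Model

variable {L M : ℕ} [NeZero L] [NeZero M] {c c' : ℕ → ℝ} {β U μ : ℝ} {K : TrigPolyC4v} {n : ℕ}

/-- The regularity conjunct. -/
theorem TwoLegReadJetBound.contDiff (h : TwoLegReadJetBound L M c c' β U μ K n) :
    ContDiff ℝ 4 (fun θ : ℝ => klLocalPart L M β U μ K n θ) := h.1

/-- The jet bound, `k ≤ 4`. -/
theorem TwoLegReadJetBound.le (h : TwoLegReadJetBound L M c c' β U μ K n) {k : ℕ} (hk : k ≤ 4) (θ : ℝ) :
    |iteratedDeriv k (fun θ : ℝ => klLocalPart L M β U μ K n θ) θ| ≤ curveJetBar c c' U k n := h.2 k hk θ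

/-- The VALUE (`k = 0`): `|ν_n(K)(θ)| ≤ curveJetBar c c' U 0 n = (c₀ + c′₀|U|)·|U|·16^{−n}`-shape. -/
theorem TwoLegReadJetBound.abs_le (h : TwoLegReadJetBound L M c c' β U μ K n) (θ : ℝ) :
    |klLocalPart L M β U μ K n θ| ≤ curveJetBar c c' U 0 n := by
  simpa using h.2 0 (Nat.zero_le _) θ

/-- **Monotone in the tables**: smaller constants ⇒ the bound at larger constants. -/
theorem TwoLegReadJetBound.mono {d d' : ℕ → ℝ} (hcd : ∀ k, c k ≤ d k) (hcd' : ∀ k, c' k ≤ d' k) (h : TwoLegReadJetBound L M c c' β U μ K n) :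
    TwoLegReadJetBound L M d d' β U μ K n :=
  ⟨h.1, fun k hk θ => (h.2 k hk θ).trans (curveJetBar_mono hcd hcd' U k n)⟩

/-- **Package form from tables below the package's size fields** (`c_k ≤ G.S k`, `c′_k ≤ Q.S' k`): the reading at `(G.S, Q.S')`. -/
theorem twoLegReadJetBound_GS_of_le (G : GeoConsts) (Q : EngConsts) (hc : ∀ k, c k ≤ G.S k) (hc' : ∀ k, c' k ≤ Q.S' k)
    (h : TwoLegReadJetBound L M c c' β U μ K n) : TwoLegReadJetBound L M G.S Q.S' β U μ K n :=
  h.mono hc hc'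

end Model

end Summit.HubbardSuperconductivity.HubbardSuperconductivity.Theorems.KLRegimeSplit

end
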